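import Summits.FinalStateConjecture.FinalStateConjecture.Theorems.BartnikGapSettlingBondiBartnikRigiditySlabCauchyRigidityDefs
import HarnessLib

/-!
# F1' `stub_slabCauchyRigidity'`, step (b) at order `0`: the metric identity on the open slab — line
# `direct-method-on-the-cone`, crux `BondiBartnikRigidity` (stmt-FinalStateConjecture-10807);
# module 6 of the landing of the conditional proof of F1'

The order-`0` half of the second input (A2) of route statement (A) `F1Route.SlabSubdatum`
(`…SlabCauchyRigidityDefs.lean`), PROVED with its statement written out (no new `Prop` definition):

* `slabMetricIdentity_holds` — **(A2h)**: for ANY smooth `Φ_N` through which an exact collar chart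
  `Φ₀` factors on the open slab (`ι ∘ Φ_N = Φ₀ ∘ (y ↦ Λ(0,y) + c)`), `Φ_N^* h = ψ_N^* g_{M,a}`:
  `h(dΦ_N v, dΦ_N w) = g(dι dΦ_N v, dι dΦ_N w)` (`induced_h`) `= g(d(Φ₀ ∘ e_N) v, d(Φ₀ ∘ e_N) w)`
  (chain rule) `= g_B(de_N v, de_N w)` (order-`0` exactness) `= g_{M,a}((0,v),(0,w))`
  (`boostedKerrBilin_apply`) `= g_{M,a}(dψ_N v, dψ_N w)` (`Kerr.mfderiv_sliceEmbed`).

Registered bookkeeping sub-goal of the line: `stub_slabMetricIdentity`.  The factorisation (A1) and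
the order-`1` identity (A2k) are the companion modules `…SlabCauchyRigidityFactorisation.lean`,
`…SlabCauchyRigiditySecondForm*.lean`.

References: O'Neill 1983, Ch. 3, p. 58 [ONeill1983].  No definitions, no named facts.
-/

noncomputable section

-- D-0017: single-problem summit, `Summit.<S>.<S>.…` by design (cf. lakefile `weak.linter.dupNamespace`).
set_option linter.dupNamespace false
set_option maxSynthPendingDepth 3

open Set Filter Function Topology TopologicalSpace Bundle
open Literature.Geometry.Lorentzian
open scoped Manifold ContDiff Topology ENNReal

namespace Summit.FinalStateConjecture.FinalStateConjecture.Theorems.BondiBartnikRigidity.DirectMethod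

namespace F1Route

/-- `Λ⁻¹((Λ z + c) − c) = z` (local copy of `poincareInv_lab` of the factorisation module, which is
landed in parallel). [folklore] -/
private theorem poincareInv_lab₀ (mo : lorentzGroup × E4) (z : E4) :
    poincareInv mo.1 mo.2 ((mo.1 : E4 ≃L[ℝ] E4) z + mo.2) = z := by
  simp [poincareInv]

set_option synthInstance.maxHeartbeats 200000 in
/-- Exactness at order `0` on the slab: the deviation vanishes at slab points (local copy of
`deviation_eq_zero_of_truncDeviationCk_le_zero` of the factorisation module). [folklore] -/
private theorem deviation_eq_zero_of_truncDeviationCk_le_zero₀ {𝒮 : Spacetime.{0} 4}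
    {B : ModelBackground} {Φ₀ : B.domain → 𝒮.carrier} {k : ℕ} {R τ : ℝ}
    (h : 𝒮.truncDeviationCk B Φ₀ k R τ ≤ 0) {x : B.domain} (hx : x ∈ B.truncTimeSlab R τ) :
    𝒮.deviation B Φ₀ x = 0 := by
  have hle := (enorm_iteratedFDeriv_le_supCkENorm (k := k) (m := 0) (Nat.zero_le _)
    (mem_image_of_mem Subtype.val hx) (𝒮.deviationExtend B Φ₀)).trans h
  have h0 : iteratedFDeriv ℝ 0 (𝒮.deviationExtend B Φ₀) x.1 = 0 := by
    have := le_antisymm hle zero_le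
    rwa [enorm_eq_zero] at this
  have h1 := congrArg (fun F => F Fin.elim0) h0
  simp only [iteratedFDeriv_zero_apply, Spacetime.deviationExtend_coe] at h1
  exact h1

/-! ### (A2h): the metric identity (order `0`) -/

set_option maxHeartbeats 1600000 in
/-- **(A2h) `slabMetricIdentity_holds`** (step (b), order `0`): for any smooth `Φ_N` through which
the collar chart factors on the open slab, `Φ_N^* h = ψ_N^* g_{M,a}`;
`h(dΦ_N v, dΦ_N w) = g(dι dΦ_N v, dι dΦ_N w)` (`induced_h`) `= g(d(Φ₀ ∘ e_N) v, d(Φ₀ ∘ e_N) w)`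
(chain rule and `ι ∘ Φ_N = Φ₀ ∘ e_N`) `= g_B(de_N v, de_N w)` (order-`0` exactness)
`= g_{M,a}((0,v),(0,w))` (`boostedKerrBilin_apply`, `de_N = Λ ∘ (v ↦ (0,v))`)
`= g_{M,a}(dψ_N v, dψ_N w)` (`Kerr.mfderiv_sliceEmbed`). [cite: ONeill1983, Ch. 3, p. 58] -/
theorem slabMetricIdentity_holds :
    ∀ (k' : ℕ) (X : Type) [TopologicalSpace X] [ChartedSpace E3 X] [IsManifold (𝓡 3) ∞ X]
      [T2Space X] [SecondCountableTopology X] [ConnectedSpace X]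
      (D : InitialDataSet (𝓡 3) X) (𝒱 : VacuumCauchyDevelopment D)
      (M a : ℝ) (mo : lorentzGroup × E4) (B : ModelBackground) (Φ₀ : B.domain → 𝒱.carrier)
      (ΦN : slabW M a → X), 0 < M → |a| < M →
    B = starBackground mo.1 mo.2 M a (fun x => Kerr.radius a (poincareInv mo.1 mo.2 x)) →
    (ContMDiffOn 𝓘(ℝ, E4) (𝓡 4) ∞ Φ₀
        {x | -1 < B.time x.1 ∧ B.time x.1 < 1 ∧ B.radius x.1 < 3 * M + 1} ∧
      IsOpenEmbedding ({x | -1 < B.time x.1 ∧ B.time x.1 < 1 ∧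
        B.radius x.1 < 3 * M + 1}.restrict Φ₀)) →
    𝒱.toSpacetime.truncDeviationCk B Φ₀ k' (3 * M) 0 ≤ 0 →
    Φ₀ '' B.truncTimeSlab (3 * M) 0 ⊆ range 𝒱.embed →
    ContMDiff (𝓡 3) (𝓡 3) ((((⊤ : ℕ∞) : WithTop ℕ∞)) + 1) ΦN →
    (∀ y : slabW M a, ∃ hx : ((mo.1 : E4 ≃L[ℝ] E4) (E4.ofTimeSpace 0 (y : E3)) + mo.2) ∈ B.domain,
        𝒱.embed (ΦN y) = Φ₀ ⟨_, hx⟩) →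
    ∀ (y : slabW M a) (v w : E3),
      D.h.inner (ΦN y) (mfderiv (𝓡 3) (𝓡 3) ΦN y v) (mfderiv (𝓡 3) (𝓡 3) ΦN y w) =
        Kerr.bilin M a (ψN M a y : E4) (mfderiv 𝓘(ℝ, E3) 𝓘(ℝ, E4) (ψN M a) y v)
          (mfderiv 𝓘(ℝ, E3) 𝓘(ℝ, E4) (ψN M a) y w) := by
  intro k' X _ _ _ _ _ _ D 𝒱 M a mo B Φ₀ ΦN hM ha hB hΦ hdev hslab hΦNs hιΦ y v w
  set P : E4 → E4 := poincareInv mo.1 mo.2 with hP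
  have hdom : (B.domain : Set E4) = P ⁻¹' (Kerr.region a M : Set E4) := by rw [hB]; rfl
  have htime : B.time = fun x => P x 0 := by rw [hB]; rfl
  have hrad : B.radius = fun x => Kerr.radius a (P x) := by rw [hB]; rfl
  have hbil : B.bilin = boostedKerrBilin mo.1 mo.2 M a := by rw [hB]; rfl
  -- the affine representative and the lab-frame slab embedding
  set A : E3 → E4 := fun z => (mo.1 : E4 ≃L[ℝ] E4) (E4.ofTimeSpace 0 z) + mo.2 with hA
  have hPA : ∀ z, P (A z) = E4.ofTimeSpace 0 z := fun z => poincareInv_lab₀ mo _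
  have hAd : ∀ z, HasFDerivAt A (((mo.1 : E4 ≃L[ℝ] E4) : E4 →L[ℝ] E4).comp E4.spaceEmbed) z :=
    fun z => (((mo.1 : E4 ≃L[ℝ] E4) : E4 →L[ℝ] E4).hasFDerivAt.comp z
      (E4.hasFDerivAt_ofTimeSpace 0 z)).add_const mo.2
  have hAs : ContDiff ℝ ∞ A :=
    (((mo.1 : E4 ≃L[ℝ] E4) : E4 →L[ℝ] E4).contDiff.comp (E4.contDiff_ofTimeSpace 0)).add
      contDiff_const
  have hmem : ∀ y : slabW M a, A (y : E3) ∈ B.domain := fun y => (hιΦ y).1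
  set eN : slabW M a → B.domain := fun y => ⟨A (y : E3), hmem y⟩ with heN
  have hcomp : ∀ y, 𝒱.embed (ΦN y) = Φ₀ (eN y) := fun y => (hιΦ y).2
  have heNs : ContMDiff 𝓘(ℝ, E3) 𝓘(ℝ, E4) ∞ eN := by
    rw [← ContMDiff.subtypeVal_comp_iff]
    exact (hAs.contMDiff.comp contMDiff_subtype_val).comp contMDiff_subtype_val
  have hdeN : ∀ y : slabW M a, mfderiv 𝓘(ℝ, E3) 𝓘(ℝ, E4) eN y =
      (((mo.1 : E4 ≃L[ℝ] E4) : E4 →L[ℝ] E4).comp E4.spaceEmbed) := by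
    intro y
    have hdAz : MDifferentiableAt 𝓘(ℝ, E3) 𝓘(ℝ, E4) (fun z : Kerr.slice a M => A z.1) y.1 :=
      ((hAs.contMDiff.comp contMDiff_subtype_val) y.1).mdifferentiableAt (by simp)
    have hd1 : MDifferentiableAt 𝓘(ℝ, E3) 𝓘(ℝ, E4) (fun y : slabW M a => A (y : E3)) y :=
      (((hAs.contMDiff.comp contMDiff_subtype_val).comp contMDiff_subtype_val) y).mdifferentiableAt
        (by simp)
    rw [OpensChart.mfderiv_codRestrict (f := fun y : slabW M a => A (y : E3)) (fun _ => rfl) hd1,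
      show (fun y : slabW M a => A (y : E3)) = (fun z : Kerr.slice a M => A z.1) ∘ Subtype.val from rfl,
      mfderiv_comp_subtypeVal hdAz,
      show (fun z : Kerr.slice a M => A z.1) = A ∘ Subtype.val from rfl,
      mfderiv_comp_subtypeVal (hAs.contMDiff.contMDiffAt.mdifferentiableAt (by simp)),
      mfderiv_eq_fderiv, (hAd _).fderiv]
  have hslabmem : ∀ y : slabW M a, eN y ∈ B.truncTimeSlab (3 * M) 0 := fun y => by
    refine ⟨?_, ?_⟩
    · rw [htime]; show P (A _) 0 = 0; rw [hPA]; rfl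
    · rw [hrad]; show Kerr.radius a (P (A _)) ≤ 3 * M; rw [hPA]; exact y.2.le
  have hlayer : ∀ y : slabW M a, eN y ∈
      {x : B.domain | -1 < B.time x.1 ∧ B.time x.1 < 1 ∧ B.radius x.1 < 3 * M + 1} := fun y => by
    obtain ⟨h0, hr⟩ := hslabmem y
    exact ⟨by rw [h0]; norm_num, by rw [h0]; norm_num, by linarith⟩
  have hLo : IsOpen {x : B.domain | -1 < B.time x.1 ∧ B.time x.1 < 1 ∧ B.radius x.1 < 3 * M + 1} := by
    have ht : Continuous fun x : B.domain => B.time x.1 := by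
      rw [htime]
      exact ((PiLp.continuous_apply 2 _ 0).comp (continuous_poincareInv _ _)).comp continuous_subtype_val
    have hr : Continuous fun x : B.domain => B.radius x.1 := by
      rw [hrad]
      exact ((Kerr.continuous_radius a).comp (continuous_poincareInv _ _)).comp continuous_subtype_val
    simp only [Set.setOf_and]
    exact (isOpen_lt continuous_const ht).inter ((isOpen_lt ht continuous_const).inter
      (isOpen_lt hr continuous_const))
  have hΦ₀d : MDifferentiableAt 𝓘(ℝ, E4) (𝓡 4) Φ₀ (eN y) :=
    ((hΦ.1 _ (hlayer y)).contMDiffAt (hLo.mem_nhds (hlayer y))).mdifferentiableAt (by simp)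
  -- chain rules
  have hfun : 𝒱.embed ∘ ΦN = Φ₀ ∘ eN := funext hcomp
  have h1 : mfderiv 𝓘(ℝ, E3) (𝓡 4) (𝒱.embed ∘ ΦN) y =
      (mfderiv (𝓡 3) (𝓡 4) 𝒱.embed (ΦN y)).comp (mfderiv (𝓡 3) (𝓡 3) ΦN y) :=
    mfderiv_comp y (𝒱.mdifferentiable_embed _) ((hΦNs y).mdifferentiableAt (by simp))
  have h2 : mfderiv 𝓘(ℝ, E3) (𝓡 4) (Φ₀ ∘ eN) y =
      (mfderiv 𝓘(ℝ, E4) (𝓡 4) Φ₀ (eN y)).comp (mfderiv 𝓘(ℝ, E3) 𝓘(ℝ, E4) eN y) :=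
    mfderiv_comp y hΦ₀d (heNs.mdifferentiableAt (by simp))
  rw [hfun, h2, hdeN y] at h1
  have hd : ∀ u : E3, mfderiv (𝓡 3) (𝓡 4) 𝒱.embed (ΦN y) (mfderiv (𝓡 3) (𝓡 3) ΦN y u) =
      mfderiv 𝓘(ℝ, E4) (𝓡 4) Φ₀ (eN y) ((mo.1 : E4 ≃L[ℝ] E4) (E4.spaceEmbed u)) :=
    fun u => (DFunLike.congr_fun h1 u).symm
  -- `h = ι^* g`, then order-`0` exactness, then the Poincaré identification
  have hind := congrArg (fun b => b (mfderiv (𝓡 3) (𝓡 3) ΦN y v) (mfderiv (𝓡 3) (𝓡 3) ΦN y w))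
    (𝒱.induced_h (ΦN y))
  simp only [pullbackBilin_apply] at hind
  rw [← hind, hd v, hd w, hcomp y]
  have hiso : ∀ v' w' : E4, 𝒱.metric.val (Φ₀ (eN y)) (mfderiv 𝓘(ℝ, E4) (𝓡 4) Φ₀ (eN y) v')
      (mfderiv 𝓘(ℝ, E4) (𝓡 4) Φ₀ (eN y) w') = B.bilin (eN y).1 v' w' := fun v' w' => by
    have h := congrArg (fun b => b v' w') (deviation_eq_zero_of_truncDeviationCk_le_zero₀ hdev (hslabmem y))
    simp only [Spacetime.deviation_apply, zero_apply, sub_eq_zero] at h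
    exact h
  rw [hiso, hbil, boostedKerrBilin_apply, ContinuousLinearEquiv.symm_apply_apply,
    ContinuousLinearEquiv.symm_apply_apply,
    show poincareInv mo.1 mo.2 (eN y).1 = (ψN M a y : E4) from hPA _,
    show ψN M a = Kerr.sliceEmbed a M ∘ Subtype.val from rfl,
    mfderiv_comp_subtypeVal ((Kerr.contMDiff_sliceEmbed a M ∞ y.1).mdifferentiableAt (by simp)),
    Kerr.mfderiv_sliceEmbed]
  rfl

end F1Route

open F1Route in
/-- **Registered bookkeeping sub-goal `stub_slabMetricIdentity` of the line** (brick of the landing of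
F1' `stub_slabCauchyRigidity'`): (A2h) — for any smooth `Φ_N` through which an exact collar chart of a
vacuum development factors on the open slab, `Φ_N^* h = ψ_N^* g_{M,a}` pointwise.
[cite: ONeill1983, Ch. 3, p. 58] -/
theorem stub_slabMetricIdentity :
    ∀ (k' : ℕ) (X : Type) [TopologicalSpace X] [ChartedSpace E3 X] [IsManifold (𝓡 3) ∞ X]
      [T2Space X] [SecondCountableTopology X] [ConnectedSpace X]
      (D : InitialDataSet (𝓡 3) X) (𝒱 : VacuumCauchyDevelopment D)
      (M a : ℝ) (mo : lorentzGroup × E4) (B : ModelBackground) (Φ₀ : B.domain → 𝒱.carrier)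
      (ΦN : F1Route.slabW M a → X), 0 < M → |a| < M →
    B = starBackground mo.1 mo.2 M a (fun x => Kerr.radius a (poincareInv mo.1 mo.2 x)) →
    (ContMDiffOn 𝓘(ℝ, E4) (𝓡 4) ∞ Φ₀
        {x | -1 < B.time x.1 ∧ B.time x.1 < 1 ∧ B.radius x.1 < 3 * M + 1} ∧
      IsOpenEmbedding ({x | -1 < B.time x.1 ∧ B.time x.1 < 1 ∧
        B.radius x.1 < 3 * M + 1}.restrict Φ₀)) →
    𝒱.toSpacetime.truncDeviationCk B Φ₀ k' (3 * M) 0 ≤ 0 →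
    Φ₀ '' B.truncTimeSlab (3 * M) 0 ⊆ range 𝒱.embed →
    ContMDiff (𝓡 3) (𝓡 3) ((((⊤ : ℕ∞) : WithTop ℕ∞)) + 1) ΦN →
    (∀ y : F1Route.slabW M a,
      ∃ hx : ((mo.1 : E4 ≃L[ℝ] E4) (E4.ofTimeSpace 0 (y : E3)) + mo.2) ∈ B.domain,
        𝒱.embed (ΦN y) = Φ₀ ⟨_, hx⟩) →
    ∀ (y : F1Route.slabW M a) (v w : E3),
      D.h.inner (ΦN y) (mfderiv (𝓡 3) (𝓡 3) ΦN y v) (mfderiv (𝓡 3) (𝓡 3) ΦN y w) =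
        Kerr.bilin M a (F1Route.ψN M a y : E4) (mfderiv 𝓘(ℝ, E3) 𝓘(ℝ, E4) (F1Route.ψN M a) y v)
          (mfderiv 𝓘(ℝ, E3) 𝓘(ℝ, E4) (F1Route.ψN M a) y w) :=
  slabMetricIdentity_holds

end Summit.FinalStateConjecture.FinalStateConjecture.Theorems.BondiBartnikRigidity.DirectMethod

end
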